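import Summits.QuantumFields.BalabanUV.Gaps.D1WardTraceForm
import Summits.QuantumFields.BalabanUV.Gaps.D1ReynoldsMeanDrift

/-!
# `BalabanUV.Gaps.D1WardLongitudinalDrift` — cell pub-balaban-gaps, row (D1), seat g1-p1: THE BINDER (D1) UNDER THE WARD BINDER, IN ITS OWN CURRENCY (`OneLoopDrift`), IS A DRIFT LAW OF ONE
# DIAGONAL CHANNEL — at EVERY `cE₂` of the β-lead's family (no pin, no limit) and at the (III′) literal; (D1) at the six channels is a drift law of the TRACE kernel's isotropic moment

HONEST FRAMING (cell rule, page 1 of everything): [folklore] composition BY NAME — rows 86 ∕ 88 of this seat (`D1WardLongitudinalForm.secondMoment_TbalOf_JsBalAn1_eq_neg_half_of_hW`,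
`D1WardTraceForm.twelve_mul_secondMoment_reynoldsMean_…_eq_trace[_of_hW]`), GEN 14's `D1ReynoldsMeanDrift.d1Drift_six_to_reynoldsMean_JsBalAn1 ∕ _JsB12CombShSym`, an2∕an4's
`OneStepKernelFamily.D1Drift` (DEFINITION: `∃ A, OneLoopDrift (stepBal N Lc) A (j ↦ secondMoment (TbalOf Lc Js j) μ ν)`).  The Ward binder `hW` (5.9) and the permutation covariance (1.21) REMAIN
HYPOTHESES on members of the cells' OWN literals; nothing of Bałaban's asserted beyond print; NO coefficient computed or signed; (D1) NOT discharged; 0∕4 row-D1 binders at the pinned ∕ (III′)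
literals; NOT `BetaPertH`, NOT continuum, NOT Clay.
HONEST DEPENDENCY (b2b cell, verbatim): «continuum YM on T⁴ ⇐ BetaPertH ∧ nine spine estimates (0/9 proved); BetaPertH ⇐ (D1) ∧ (D4) ∧ CAP+tail; G-an2-4 gates asym, D1 and NE2/3/4.»

WHY (census row 89 of `HOME/g1/RESIDUE.md`).  Row 86 §3 read (D1) on a diagonal channel AT THE PIN through the constructed limit (g1-p3's rate certificate).  The binder itself is a
`OneLoopDrift` law of the SEQUENCE `j ↦ β⁰_j(μ,ν)` — no limit in its definition — so the diagonal reading holds termwise WITHOUT the pin: for every `cE₂`, root, colour triple, `cB`, `T`,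
under `∀ j, hW_j`, **`D1Drift Lc (JsBalAn1 …) N μ ν ⟺ ∃ A, OneLoopDrift (stepBal N Lc) A (j ↦ −½ Σ_z T_j(ν,ν,z) z_μ²)`** (`μ ≠ ν`), the same at the (III′) literal; and GEN 14's six-channel
reading becomes a drift law of an AXIS-ORDER-BLIND scalar: **(D1) at the six channels + `∀ j, hW_j` ⟹ `∃ A, OneLoopDrift (stepBal N Lc) A (j ↦ −(1∕24) Σ_ν Σ_z T_j(ν,ν,z) |z|²)`**; under
`∀ j, (1.21)_j` the converse direction closes: (D1) in ANY channel ⟺ that trace drift law.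
WHAT IT IS NOT: nothing is discharged; the words of the row do not move.

CONTENT (all [folklore]; no `def`, 0 sorry): §1 pinned family (any `1 ≤ Lc`, root, colours, `cE₂`, `cB`, `T`): **`d1Drift_JsBalAn1_iff_longitudinalDrift_of_hW`**,
**`traceDrift_JsBalAn1_of_d1Drift_six_of_hW`**, `d1Drift_JsBalAn1_iff_traceDrift_of_hW_permCovariant`; §2 the (III′) literal: `d1Drift_JsB12CombShSym_iff_longitudinalDrift_of_hW`,
`traceDrift_JsB12CombShSym_of_d1Drift_six_of_hW`.

Provenance: cell pub-balaban-gaps, seat g1-p1 GEN 17 (prover-pub-balaban-gaps-g1-p1-g17-0), 2026-08-25; imports this seat's `Gaps/D1WardTraceForm` (p402435 ✓) + GEN 14's `Gaps/D1ReynoldsMeanDrift`;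
no existing file touched.
-/

noncomputable section

open Literature.MathematicalPhysics.QuantumFieldTheory Balaban1983to89 Balaban1983to89.Beta
open OneStepResolventKernel (JetData)
open OneStepKernelFamily (TbalOf flipK D1Drift secondMoment_flipK)
open PolarizationSign (WardTransversal)
open Drift (OneLoopDrift)
open AffineAveraging (box)
open Summit.QuantumFields.BalabanUV.Beta.MixedJetTablesPlug (JsBalAn1)
open Summit.QuantumFields.BalabanUV.Beta.CombChartJointEnd (JsB12CombShSym)
open Summit.QuantumFields.BalabanUV.Beta.SymmetrisedStepJets (SymTables)
open Summit.QuantumFields.BalabanUV.Beta.D1BFx.PermCovariantReynolds (reynoldsMean)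
open Summit.QuantumFields.BalabanUV.Gaps.D1WardLongitudinalForm (secondMoment_TbalOf_JsBalAn1_eq_neg_half_of_hW secondMoment_TbalOf_JsB12CombShSym_eq_neg_half_of_hW)
open Summit.QuantumFields.BalabanUV.Gaps.D1WardTraceForm (twelve_mul_secondMoment_reynoldsMean_JsBalAn1_eq_trace_of_hW secondMoment_TbalOf_JsBalAn1_eq_trace_of_hW_permCovariant
  twelve_mul_secondMoment_reynoldsMean_JsB12CombShSym_eq_trace_of_hW)
open Summit.QuantumFields.BalabanUV.Gaps.D1ReynoldsMeanDrift (d1Drift_six_to_reynoldsMean_JsBalAn1 d1Drift_six_to_reynoldsMean_JsB12CombShSym)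

namespace Summit.QuantumFields.BalabanUV.Gaps.D1WardLongitudinalDrift

/-! ## §1 The β-lead's family `JsBalAn1(r; c⃗; cE₂; cB; T)` — no pin, no limit -/

section Pinned

variable {Lc : ℕ} [NeZero Lc] {r : Fin (3 + 1) → ℕ}

/-- [folklore] **(D1) UNDER THE WARD BINDER IS A ONE-LOOP DRIFT LAW OF ONE DIAGONAL CHANNEL — AT EVERY `cE₂`, WITHOUT THE PIN**: if every level's flipped step kernel is Ward-transversal, then
for `μ ≠ ν` `D1Drift Lc (JsBalAn1 …) N μ ν ⟺ ∃ A, OneLoopDrift (stepBal N Lc) A (j ↦ −½ Σ_z T_j(ν,ν,z) z_μ²)` — the binder's own sequence IS that sequence term by term (row 86). -/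
theorem d1Drift_JsBalAn1_iff_longitudinalDrift_of_hW (hLc : 1 ≤ Lc) (hr : r ∈ box (3 + 1) Lc) (cE cVH cΛ cE₂ cB : ℝ) (T : Fin 4 → Fin 4 → Fin 4 → Fin 4 → ℝ) {μ ν : Fin 4} (hμν : μ ≠ ν)
    (N : ℝ) (hW : ∀ j : ℕ, WardTransversal (flipK (TbalOf Lc (JsBalAn1 hLc hr cE cVH cΛ cE₂ cB T) j))) :
    D1Drift Lc (JsBalAn1 hLc hr cE cVH cΛ cE₂ cB T) N μ ν ↔
      ∃ A : ℝ, OneLoopDrift (B12Normalization.stepBal N Lc) A (fun j => -(1 / 2) * ∑' z, TbalOf Lc (JsBalAn1 hLc hr cE cVH cΛ cE₂ cB T) j ν ν z * (z μ : ℝ) ^ 2) := by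
  have h : (fun j => B12Beta.secondMoment (TbalOf Lc (JsBalAn1 hLc hr cE cVH cΛ cE₂ cB T) j) μ ν) =
      fun j => -(1 / 2) * ∑' z, TbalOf Lc (JsBalAn1 hLc hr cE cVH cΛ cE₂ cB T) j ν ν z * (z μ : ℝ) ^ 2 :=
    funext fun j => secondMoment_TbalOf_JsBalAn1_eq_neg_half_of_hW hLc hr cE cVH cΛ cE₂ cB T j (hW j) hμν
  unfold D1Drift
  rw [h]

/-- [folklore] **(D1) AT THE SIX CHANNELS, UNDER THE WARD BINDER, IS A DRIFT LAW OF THE TRACE KERNEL's ISOTROPIC SECOND MOMENT**: `(∀ a < b, D1Drift … N a b)` and `∀ j, hW_j` give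
`∃ A, OneLoopDrift (stepBal N Lc) A (j ↦ −(1∕24) Σ_ν Σ_z T_j(ν,ν,z) |z|²)` — GEN 14's Reynolds-mean drift (`d1Drift_six_to_reynoldsMean_JsBalAn1`) read through row 88's trace form; the scalar
is blind to the ORDER of the axes. -/
theorem traceDrift_JsBalAn1_of_d1Drift_six_of_hW (hLc : 1 ≤ Lc) (hr : r ∈ box (3 + 1) Lc) (cE cVH cΛ cE₂ cB : ℝ) (T : Fin 4 → Fin 4 → Fin 4 → Fin 4 → ℝ) (N : ℝ)
    (h : ∀ p ∈ (Finset.univ.filter fun p : Fin 4 × Fin 4 => p.1 < p.2), D1Drift Lc (JsBalAn1 hLc hr cE cVH cΛ cE₂ cB T) N p.1 p.2)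
    (hW : ∀ j : ℕ, WardTransversal (flipK (TbalOf Lc (JsBalAn1 hLc hr cE cVH cΛ cE₂ cB T) j))) :
    ∃ A : ℝ, OneLoopDrift (B12Normalization.stepBal N Lc) A
      (fun j => -(1 / 24) * ∑ ν, ∑' z, TbalOf Lc (JsBalAn1 hLc hr cE cVH cΛ cE₂ cB T) j ν ν z * ∑ μ, (z μ : ℝ) ^ 2) := by
  have h01 : (0 : Fin 4) ≠ 1 := by decide
  obtain ⟨A, hA⟩ := d1Drift_six_to_reynoldsMean_JsBalAn1 hLc hr cE cVH cΛ cE₂ cB T N h h01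
  refine ⟨A, ?_⟩
  have e : (fun j => B12Beta.secondMoment (reynoldsMean (flipK (TbalOf Lc (JsBalAn1 hLc hr cE cVH cΛ cE₂ cB T) j))) 0 1) =
      fun j => -(1 / 24) * ∑ ν, ∑' z, TbalOf Lc (JsBalAn1 hLc hr cE cVH cΛ cE₂ cB T) j ν ν z * ∑ μ, (z μ : ℝ) ^ 2 := by
    funext j
    have h12 := twelve_mul_secondMoment_reynoldsMean_JsBalAn1_eq_trace_of_hW hLc hr cE cVH cΛ cE₂ cB T j (hW j) h01
    linarith
  rw [← e]
  exact hA

/-- [folklore] … and under `∀ j, hW_j` + the printed (1.21) at every level (a HYPOTHESIS; fails by value for the record at level 0): (D1) in ANY channel `μ ≠ ν` ⟺ the trace drift law. -/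
theorem d1Drift_JsBalAn1_iff_traceDrift_of_hW_permCovariant (hLc : 1 ≤ Lc) (hr : r ∈ box (3 + 1) Lc) (cE cVH cΛ cE₂ cB : ℝ) (T : Fin 4 → Fin 4 → Fin 4 → Fin 4 → ℝ) {μ ν : Fin 4}
    (hμν : μ ≠ ν) (N : ℝ) (hW : ∀ j : ℕ, WardTransversal (flipK (TbalOf Lc (JsBalAn1 hLc hr cE cVH cΛ cE₂ cB T) j)))
    (hC : ∀ j : ℕ, B12Beta.PermCovariant (flipK (TbalOf Lc (JsBalAn1 hLc hr cE cVH cΛ cE₂ cB T) j))) :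
    D1Drift Lc (JsBalAn1 hLc hr cE cVH cΛ cE₂ cB T) N μ ν ↔
      ∃ A : ℝ, OneLoopDrift (B12Normalization.stepBal N Lc) A
        (fun j => -(1 / 24) * ∑ ν, ∑' z, TbalOf Lc (JsBalAn1 hLc hr cE cVH cΛ cE₂ cB T) j ν ν z * ∑ μ, (z μ : ℝ) ^ 2) := by
  have e : (fun j => B12Beta.secondMoment (TbalOf Lc (JsBalAn1 hLc hr cE cVH cΛ cE₂ cB T) j) μ ν) =
      fun j => -(1 / 24) * ∑ ν, ∑' z, TbalOf Lc (JsBalAn1 hLc hr cE cVH cΛ cE₂ cB T) j ν ν z * ∑ μ, (z μ : ℝ) ^ 2 := by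
    funext j
    have h12 := secondMoment_TbalOf_JsBalAn1_eq_trace_of_hW_permCovariant hLc hr cE cVH cΛ cE₂ cB T j (hW j) (hC j) hμν
    linarith
  unfold D1Drift
  rw [e]

end Pinned

/-! ## §2 The b2b wall's (III′) literal over every table record -/

section Record

variable {Lc : ℕ} [NeZero Lc]

/-- [folklore] **(D1) FOR THE (III′) LITERAL UNDER THE WARD BINDER IS A ONE-LOOP DRIFT LAW OF ONE DIAGONAL CHANNEL** (every table record `tabs`, `N`, `cΛ`, `cB`; `Odd Lc`; `μ ≠ ν`). -/
theorem d1Drift_JsB12CombShSym_iff_longitudinalDrift_of_hW (hLc : Odd Lc) (N : ℕ) (tabs : SymTables 3 Lc) (cΛ cB : ℝ) {μ ν : Fin 4} (hμν : μ ≠ ν) (Nc : ℝ)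
    (hW : ∀ j : ℕ, WardTransversal (flipK (TbalOf Lc (JsB12CombShSym hLc N tabs cΛ cB) j))) :
    D1Drift Lc (JsB12CombShSym hLc N tabs cΛ cB) Nc μ ν ↔
      ∃ A : ℝ, OneLoopDrift (B12Normalization.stepBal Nc Lc) A (fun j => -(1 / 2) * ∑' z, TbalOf Lc (JsB12CombShSym hLc N tabs cΛ cB) j ν ν z * (z μ : ℝ) ^ 2) := by
  have h : (fun j => B12Beta.secondMoment (TbalOf Lc (JsB12CombShSym hLc N tabs cΛ cB) j) μ ν) =
      fun j => -(1 / 2) * ∑' z, TbalOf Lc (JsB12CombShSym hLc N tabs cΛ cB) j ν ν z * (z μ : ℝ) ^ 2 :=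
    funext fun j => secondMoment_TbalOf_JsB12CombShSym_eq_neg_half_of_hW hLc N tabs cΛ cB j (hW j) hμν
  unfold D1Drift
  rw [h]

/-- [folklore] **(D1) AT THE SIX CHANNELS OF THE (III′) LITERAL, UNDER THE WARD BINDER, IS A DRIFT LAW OF ITS TRACE KERNEL's ISOTROPIC SECOND MOMENT.** -/
theorem traceDrift_JsB12CombShSym_of_d1Drift_six_of_hW (hLc : Odd Lc) (N : ℕ) (tabs : SymTables 3 Lc) (cΛ cB : ℝ) (Nc : ℝ)
    (h : ∀ p ∈ (Finset.univ.filter fun p : Fin 4 × Fin 4 => p.1 < p.2), D1Drift Lc (JsB12CombShSym hLc N tabs cΛ cB) Nc p.1 p.2)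
    (hW : ∀ j : ℕ, WardTransversal (flipK (TbalOf Lc (JsB12CombShSym hLc N tabs cΛ cB) j))) :
    ∃ A : ℝ, OneLoopDrift (B12Normalization.stepBal Nc Lc) A
      (fun j => -(1 / 24) * ∑ ν, ∑' z, TbalOf Lc (JsB12CombShSym hLc N tabs cΛ cB) j ν ν z * ∑ μ, (z μ : ℝ) ^ 2) := by
  have h01 : (0 : Fin 4) ≠ 1 := by decide
  obtain ⟨A, hA⟩ := d1Drift_six_to_reynoldsMean_JsB12CombShSym hLc N tabs cΛ cB Nc h h01
  refine ⟨A, ?_⟩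
  have e : (fun j => B12Beta.secondMoment (reynoldsMean (flipK (TbalOf Lc (JsB12CombShSym hLc N tabs cΛ cB) j))) 0 1) =
      fun j => -(1 / 24) * ∑ ν, ∑' z, TbalOf Lc (JsB12CombShSym hLc N tabs cΛ cB) j ν ν z * ∑ μ, (z μ : ℝ) ^ 2 := by
    funext j
    have h12 := twelve_mul_secondMoment_reynoldsMean_JsB12CombShSym_eq_trace_of_hW hLc N tabs cΛ cB j (hW j) h01
    linarith
  rw [← e]
  exact hA

end Record

end Summit.QuantumFields.BalabanUV.Gaps.D1WardLongitudinalDrift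

end
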